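import Mathlib
import HarnessLib
import Summits.CriticalPhenomena.Ising3DConformalLimit.Theorems.ArmDressingEvenPatternDecouplingAssemblyBirth

/-!
# Crux `EvenPatternDecoupling` (stmt-CriticalPhenomena-16133), line `registered`: the reading-scale ASSEMBLY of the heart

`pieces_assembly2` (line skeleton revision 4, lead c1, proved; landed here unchanged, binders closed at `Type`): for finite
measures `μ L` carried by `Supp L`, point events `E, A` (pattern, arms), ball events `E2, B`, reading events `Uni, Patt` and an
abstract far-measurability predicate, the point→reading and ball→reading deterministic transfers on the support, uniqueness of
the reading-scale crossing clusters given the arms, TV ratio mixing of far events between point- and ball-arm conditioning, and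
the existence of the infinite-volume limits (arm limits non-null) imply the locally uniform point-to-ball decoupling of the
infinite-volume ratios (`measureReal_transfer`, `abs_div_sub_div_le`; reading radius `min(t₀, slack)/2`, neighbourhood shrunk
into `∏ B(z₀_j, tt/4)`, `η₀ ≤ tt/6`, vacuous case for far inner families).
-/

namespace Summit.CriticalPhenomena.Ising3DConformalLimit.Theorems.EvenPatternDecoupling

open scoped Topology
open Filter Set Metric

/-- Real-analysis division lemma: a bound `|a - x| ≤ e·d` on numerators gives `|a/d - x/d| ≤ e`
(all sign cases of `d`, with the convention `x / 0 = 0`). -/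
theorem abs_div_sub_div_le {a x d e : ℝ} (he : 0 ≤ e) (h : |a - x| ≤ e * d) :
    |a / d - x / d| ≤ e := by
  rcases le_or_gt d 0 with hd | hd
  · have h0 : |a - x| ≤ 0 := h.trans (mul_nonpos_of_nonneg_of_nonpos he hd)
    have hax : a - x = 0 := abs_nonpos_iff.1 h0
    rw [← sub_div, hax, zero_div, abs_zero]; exact he
  · rw [← sub_div, abs_div, abs_of_pos hd, div_le_iff₀ hd]; exact h

/-- Measure-theoretic transfer step (finite volume): if on the support `S` the event `E` forces `A`,
and on `A ∩ U` the events `E` and `P` coincide, then `|μ(E) - μ(U ∩ P ∩ A)| ≤ μ(A ∩ Uᶜ)`. -/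
theorem measureReal_transfer {Ω : Type*} [MeasurableSpace Ω] (μ : MeasureTheory.Measure Ω)
    [MeasureTheory.IsFiniteMeasure μ] {S E A U P : Set Ω} (hS : μ.real Sᶜ = 0)
    (hEA : ∀ ω ∈ S, ω ∈ E → ω ∈ A) (hiff : ∀ ω ∈ S, ω ∈ A → ω ∈ U → (ω ∈ E ↔ ω ∈ P)) :
    |μ.real E - μ.real (U ∩ P ∩ A)| ≤ μ.real (A ∩ Uᶜ) := by
  have h1 : μ.real E ≤ μ.real (U ∩ P ∩ A) + μ.real (A ∩ Uᶜ) := by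
    have hsub : E ⊆ ((U ∩ P ∩ A) ∪ (A ∩ Uᶜ)) ∪ Sᶜ := by
      intro ω hω
      by_cases hs : ω ∈ S
      · left
        have hA : ω ∈ A := hEA ω hs hω
        by_cases hU : ω ∈ U
        · exact Or.inl ⟨⟨hU, (hiff ω hs hA hU).1 hω⟩, hA⟩
        · exact Or.inr ⟨hA, hU⟩
      · exact Or.inr hs
    calc μ.real E ≤ μ.real (((U ∩ P ∩ A) ∪ (A ∩ Uᶜ)) ∪ Sᶜ) := MeasureTheory.measureReal_mono hsub
      _ ≤ μ.real ((U ∩ P ∩ A) ∪ (A ∩ Uᶜ)) + μ.real Sᶜ := MeasureTheory.measureReal_union_le _ _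
      _ ≤ (μ.real (U ∩ P ∩ A) + μ.real (A ∩ Uᶜ)) + μ.real Sᶜ :=
          add_le_add (MeasureTheory.measureReal_union_le _ _) le_rfl
      _ = μ.real (U ∩ P ∩ A) + μ.real (A ∩ Uᶜ) := by rw [hS, add_zero]
  have h2 : μ.real (U ∩ P ∩ A) ≤ μ.real E := by
    have hsub : U ∩ P ∩ A ⊆ E ∪ Sᶜ := by
      intro ω hω
      by_cases hs : ω ∈ S
      · exact Or.inl ((hiff ω hs hω.2 hω.1.1).2 hω.1.2)
      · exact Or.inr hs
    calc μ.real (U ∩ P ∩ A) ≤ μ.real (E ∪ Sᶜ) := MeasureTheory.measureReal_mono hsub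
      _ ≤ μ.real E + μ.real Sᶜ := MeasureTheory.measureReal_union_le _ _
      _ = μ.real E := by rw [hS, add_zero]
  rw [abs_le]; constructor <;> linarith

/-- ASSEMBLY OF THE KESTEN-DECOUPLING TARGET FROM READING-SCALE PIECES (abstract, proved). For finite measures
`μ L` carried by `Supp L`, point events `E, A` (pattern, arms), ball events `E2, B` indexed by the inner family,
reading events `Uni, Patt` indexed by a reading family, and an abstract far-measurability predicate `Far`:
the point→reading and ball→reading DETERMINISTIC transfers on `Supp`, UNIQUENESS of the reading-scale crossing
clusters given the arms (for small reading radii), TV RATIO MIXING of far events between point- and ball-arm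
conditioning (for inner radii small against the reading radii), and the EXISTENCE of the infinite-volume limits
(arm limits non-null) imply the locally uniform point-to-ball decoupling of the infinite-volume ratios.
The reading radius is `tt = min(t₀, admissibility slack)/2`; the neighbourhood is shrunk into `∏ B(z₀_j, tt/4)`
and `η₀ ≤ tt/6`, so an inner family either lies inside `B(z₀_j, tt/2)` (main case) or contains no point of the
neighbourhood well inside (vacuous case). -/
-- the header below is the registered stub signature (whitespace-compressed; binders closed at `Type`)
theorem pieces_assembly2 : open Filter Set Metric Topology in ∀ {ι X : Type} [Fintype ι] [PseudoMetricSpace X] {Ω : ℕ→Type} [∀ L, MeasurableSpace (Ω L)] (μ : ∀ L, MeasureTheory.Measure (Ω L)) (hfin : ∀ L, MeasureTheory.IsFiniteMeasure (μ L)) (Supp : ∀ L, Set (Ω L)) (hsupp : ∀ L, (μ L).real (Supp L)ᶜ = 0) (c : ι→X) (r : ι→ℝ) (E A : ℝ→(ι→X)→∀ L, Set (Ω L)) (E2 B Uni Patt : ℝ→(ι→X)→(ι→ℝ)→∀ L, Set (Ω L)) (Far : ℝ→(ι→X)→(ι→ℝ)→∀ L, Set (Ω L)→Prop) (hfar : ∀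 δ b' t L, Far δ b' t L (Uni δ b' t L ∩ Patt δ b' t L)) (hdet1 : ∀ (b' : ι→X) (t : ι→ℝ), (∀ j, 0 < t j)→(∀ j, closedBall (b' j) (t j) ⊆ ball (c j) (r j))→∃ δ₀ : ℝ, 0 < δ₀ ∧ ∀ δ : ℝ, 0 < δ→δ < δ₀→∀ z : ι→X, (∀ j, z j ∈ ball (b' j) (t j / 2))→∀ᶠ L in atTop, ∀ ω : Ω L, ω ∈ Supp L→(ω ∈ E δ z L→ω ∈ A δ z L) ∧ (ω ∈ A δ z L→ω ∈ Uni δ b' t L→(ω ∈ E δ z L ↔ ω ∈ Patt δ b' t L))) (hdet2 : ∀ (b' : ι→X) (t : ι→ℝ), (∀ j, 0 < t j)→(∀ j, closedBall (b' j) (t j) ⊆ ball (c j) (r j))→∀ (b : ι→X) (s : ι→ℝ), (∀ j, 0 < s j)→(∀ j, closedBall (b j) (s j) ⊆ closedBall (b' j) (t j))→∃ δ₀ : ℝ, 0 < δ₀ ∧ ∀ δ : ℝ, 0 < δ→δ < δ₀→∀ᶠ L in atTop, ∀ ω : Ω L, ω ∈ Supp L→(ω ∈ E2 δ b s L→ω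 ∈ B δ b s L) ∧ (ω ∈ B δ b s L→ω ∈ Uni δ b' t L→(ω ∈ E2 δ b s L ↔ ω ∈ Patt δ b' t L))) (huni : ∀ z₀ : ι→X, (∀ j, z₀ j ∈ ball (c j) (r j))→∀ ε : ℝ, 0 < ε→∃ t₀ : ℝ, 0 < t₀ ∧ ∀ t : ι→ℝ, (∀ j, 0 < t j ∧ t j < t₀)→(∀ j, closedBall (z₀ j) (t j) ⊆ ball (c j) (r j))→∃ V ∈ 𝓝 z₀, ∃ η₀ : ℝ, 0 < η₀ ∧ ∀ (b : ι→X) (s : ι→ℝ), (∀ j, 0 < s j ∧ s j < η₀)→(∀ j, closedBall (b j) (s j) ⊆ ball (z₀ j) (t j / 2))→∀ᶠ δ in 𝓝[>] 0, ∀ z ∈ V, (∀ j, z j ∈ ball (b j) (s j / 2))→∀ᶠ L in atTop, (μ L).real (A δ z L ∩ (Uni δ z₀ t L)ᶜ) ≤ ε * (μ L).real (A δ z L) ∧ (μ L).real (B δ b s L ∩ (Uni δ z₀ t L)ᶜ) ≤ ε * (μ L).real (B δ b s L)) (hmix : ∀ z₀ : ι→X, (∀ j, z₀ j ∈ ball (c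 j) (r j))→∀ t : ι→ℝ, (∀ j, 0 < t j)→(∀ j, closedBall (z₀ j) (t j) ⊆ ball (c j) (r j))→∀ ε : ℝ, 0 < ε→∃ V ∈ 𝓝 z₀, ∃ η₀ : ℝ, 0 < η₀ ∧ ∀ (b : ι→X) (s : ι→ℝ), (∀ j, 0 < s j ∧ s j < η₀)→(∀ j, closedBall (b j) (s j) ⊆ ball (z₀ j) (t j / 2))→∀ᶠ δ in 𝓝[>] 0, ∀ z ∈ V, (∀ j, z j ∈ ball (b j) (s j / 2))→∀ Eν : ∀ L, Set (Ω L), (∀ L, Far δ z₀ t L (Eν L))→∀ᶠ L in atTop, |(μ L).real (Eν L ∩ A δ z L) / (μ L).real (A δ z L) - (μ L).real (Eν L ∩ B δ b s L) / (μ L).real (B δ b s L)| ≤ ε) (hlimA : ∀ (b : ι→X) (s : ι→ℝ) (z : ι→X) (δ : ℝ), 0 < δ→(∀ j, δ ≤ s j)→(∃ a : ℝ, 0 < a ∧ Tendsto (fun L=>(μ L).real (A δ z L)) atTop (𝓝 a)) ∧ (∃ a : ℝ, 0 < a ∧ Tendsto (fun L=>(μ L).real (B δ b s L)) atTop (𝓝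 a))) (hlimE : ∀ (z : ι→X) (δ : ℝ), 0 < δ→∃ a : ℝ, Tendsto (fun L=>(μ L).real (E δ z L)) atTop (𝓝 a)) (hlimE2 : ∀ (b : ι→X) (s : ι→ℝ) (δ : ℝ), 0 < δ→∃ a : ℝ, Tendsto (fun L=>(μ L).real (E2 δ b s L)) atTop (𝓝 a)) (hlimPA : ∀ (b' : ι→X) (t : ι→ℝ) (z : ι→X) (δ : ℝ), 0 < δ→∃ a : ℝ, Tendsto (fun L=>(μ L).real (Uni δ b' t L ∩ Patt δ b' t L ∩ A δ z L)) atTop (𝓝 a)) (hlimPB : ∀ (b' : ι→X) (t : ι→ℝ) (b : ι→X) (s : ι→ℝ) (δ : ℝ), 0 < δ→∃ a : ℝ, Tendsto (fun L=>(μ L).real (Uni δ b' t L ∩ Patt δ b' t L ∩ B δ b s L)) atTop (𝓝 a)), ∀ z₀ : ι→X, (∀ j, z₀ j ∈ ball (c j) (r j))→∀ ε : ℝ, 0 < ε→∃ V ∈ 𝓝 z₀, ∃ η₀ : ℝ, 0 < η₀ ∧ ∀ (b : ι→X) (s : ι→ℝ), (∀ j, 0 < s j ∧ s j < η₀)→(∀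 j, closedBall (b j) (s j) ⊆ ball (c j) (r j))→∀ᶠ δ in 𝓝[>] 0, ∀ z ∈ V, (∀ j, z j ∈ ball (b j) (s j / 2))→|limUnder atTop (fun L=>(μ L).real (E δ z L)) / limUnder atTop (fun L=>(μ L).real (A δ z L)) - limUnder atTop (fun L=>(μ L).real (E2 δ b s L)) / limUnder atTop (fun L=>(μ L).real (B δ b s L))| ≤ ε := by
  intro ι X _ _ Ω _ μ hfin Supp hsupp c r E A E2 B Uni Patt Far hfar hdet1 hdet2 huni hmix hlimA hlimE hlimE2
    hlimPA hlimPB z₀ hz₀ ε hε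
  have hε3 : 0 < ε / 3 := by positivity
  -- (0) the reading family: centre `z₀`, common radius `tt` below the uniqueness threshold and the slack
  obtain ⟨t₀, ht₀, HU⟩ := huni z₀ hz₀ (ε / 3) hε3
  obtain ⟨η₁, hη₁, hadm₁⟩ := admissible_of_fine c r z₀ hz₀
  set tt : ℝ := min t₀ η₁ / 2 with htt_def
  have htt : 0 < tt := by positivity
  have htt₀ : tt < t₀ := by
    have := min_le_left t₀ η₁; rw [htt_def]; linarith
  have httη : tt < η₁ := by
    have := min_le_right t₀ η₁; rw [htt_def]; linarith
  have htadm : ∀ j, closedBall (z₀ j) ((fun _ : ι => tt) j) ⊆ ball (c j) (r j) :=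
    hadm₁ z₀ (fun _ => tt) (fun _ => ⟨htt, httη⟩) fun j => mem_ball_self (half_pos htt)
  obtain ⟨V₁, hV₁, η₂, hη₂, HU'⟩ := HU (fun _ => tt) (fun _ => ⟨htt, htt₀⟩) htadm
  obtain ⟨V₂, hV₂, η₃, hη₃, HM⟩ := hmix z₀ hz₀ (fun _ => tt) (fun _ => htt) htadm (ε / 3) hε3
  obtain ⟨δ₁, hδ₁, HD1⟩ := hdet1 z₀ (fun _ => tt) (fun _ => htt) htadm
  -- the neighbourhood and the fineness threshold
  have hopen : IsOpen {z : ι → X | ∀ j, z j ∈ ball (z₀ j) (tt / 4)} := by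
    have hEq : {z : ι → X | ∀ j, z j ∈ ball (z₀ j) (tt / 4)} =
        ⋂ j, (fun z : ι → X => z j) ⁻¹' ball (z₀ j) (tt / 4) := by
      ext z; simp
    rw [hEq]
    exact isOpen_iInter_of_finite fun j => isOpen_ball.preimage (continuous_apply j)
  have hself : ∀ j, z₀ j ∈ ball (z₀ j) (tt / 4) := fun j => mem_ball_self (by positivity)
  refine ⟨V₁ ∩ V₂ ∩ {z | ∀ j, z j ∈ ball (z₀ j) (tt / 4)},
    inter_mem (inter_mem hV₁ hV₂) (hopen.mem_nhds hself), min (min η₂ η₃) (tt / 6),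
    lt_min (lt_min hη₂ hη₃) (by positivity), fun b s hs hadm => ?_⟩
  have hs₂ : ∀ j, 0 < s j ∧ s j < η₂ := fun j =>
    ⟨(hs j).1, lt_of_lt_of_le (hs j).2 ((min_le_left _ _).trans (min_le_left _ _))⟩
  have hs₃ : ∀ j, 0 < s j ∧ s j < η₃ := fun j =>
    ⟨(hs j).1, lt_of_lt_of_le (hs j).2 ((min_le_left _ _).trans (min_le_right _ _))⟩
  have hs₆ : ∀ j, s j < tt / 6 := fun j => lt_of_lt_of_le (hs j).2 (min_le_right _ _)
  by_cases hin : ∀ j, closedBall (b j) (s j) ⊆ ball (z₀ j) ((fun _ : ι => tt) j / 2)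
  · -- MAIN CASE: the inner family lies inside the reading balls
    obtain ⟨δ₂, hδ₂, HD2⟩ := hdet2 z₀ (fun _ => tt) (fun _ => htt) htadm b s (fun j => (hs j).1)
      (fun j x hx => by
        have h := mem_ball.1 (hin j hx)
        rw [mem_closedBall]
        simp only at h ⊢
        linarith)
    have hpos : ∀ᶠ δ in 𝓝[>] (0:ℝ), 0 < δ := eventually_mem_nhdsWithin
    have hsmall₁ : ∀ᶠ δ in 𝓝[>] (0:ℝ), δ < δ₁ :=
      (eventually_lt_nhds hδ₁).filter_mono nhdsWithin_le_nhds
    have hsmall₂ : ∀ᶠ δ in 𝓝[>] (0:ℝ), δ < δ₂ :=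
      (eventually_lt_nhds hδ₂).filter_mono nhdsWithin_le_nhds
    have hδs : ∀ᶠ δ in 𝓝[>] (0:ℝ), ∀ j, δ ≤ s j :=
      eventually_all.2 fun j => (eventually_le_nhds (hs j).1).filter_mono nhdsWithin_le_nhds
    filter_upwards [HU' b s hs₂ hin, HM b s hs₃ hin, hpos, hsmall₁, hsmall₂, hδs]
      with δ hU hMx hδpos hδ1 hδ2 hδsj z hz hzin
    have hzt : ∀ j, z j ∈ ball (z₀ j) ((fun _ : ι => tt) j / 2) := fun j => by
      have h := mem_ball.1 (hz.2 j)
      exact mem_ball.2 (by simp only; linarith)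
    have hdet1L := HD1 δ hδpos hδ1 z hzt
    have hdet2L := HD2 δ hδpos hδ2
    have huniL := hU z hz.1.1 hzin
    have hmixL := hMx z hz.1.2 hzin (fun L => Uni δ z₀ (fun _ => tt) L ∩ Patt δ z₀ (fun _ => tt) L)
      fun L => hfar δ z₀ (fun _ => tt) L
    obtain ⟨⟨a, ha0, ha⟩, ⟨a', ha0', ha'⟩⟩ := hlimA b s z δ hδpos hδsj
    obtain ⟨e, he⟩ := hlimE z δ hδpos
    obtain ⟨e2, he2⟩ := hlimE2 b s δ hδpos
    obtain ⟨x, hx⟩ := hlimPA z₀ (fun _ => tt) z δ hδpos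
    obtain ⟨x', hx'⟩ := hlimPB z₀ (fun _ => tt) b s δ hδpos
    rw [he.limUnder_eq, ha.limUnder_eq, he2.limUnder_eq, ha'.limUnder_eq]
    -- (1) point transfer in the limit: `|e - x| ≤ ε/3 · a`
    have h1 : |e - x| ≤ ε / 3 * a := by
      have hev : ∀ᶠ L in atTop, |(μ L).real (E δ z L) -
          (μ L).real (Uni δ z₀ (fun _ => tt) L ∩ Patt δ z₀ (fun _ => tt) L ∩ A δ z L)| -
            ε / 3 * (μ L).real (A δ z L) ≤ 0 := by
        filter_upwards [hdet1L, huniL] with L hdL huL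
        haveI := hfin L
        have ht := measureReal_transfer (μ L) (hsupp L) (fun ω hω => (hdL ω hω).1)
          (fun ω hω => (hdL ω hω).2)
        linarith [huL.1]
      have hlimt : Tendsto (fun L => |(μ L).real (E δ z L) -
          (μ L).real (Uni δ z₀ (fun _ => tt) L ∩ Patt δ z₀ (fun _ => tt) L ∩ A δ z L)| -
            ε / 3 * (μ L).real (A δ z L)) atTop (𝓝 (|e - x| - ε / 3 * a)) :=
        ((he.sub hx).abs).sub (ha.const_mul (ε / 3))
      linarith [le_of_tendsto hlimt hev]
    -- (2) ball transfer in the limit: `|e2 - x'| ≤ ε/3 · a'`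
    have h2 : |e2 - x'| ≤ ε / 3 * a' := by
      have hev : ∀ᶠ L in atTop, |(μ L).real (E2 δ b s L) -
          (μ L).real (Uni δ z₀ (fun _ => tt) L ∩ Patt δ z₀ (fun _ => tt) L ∩ B δ b s L)| -
            ε / 3 * (μ L).real (B δ b s L) ≤ 0 := by
        filter_upwards [hdet2L, huniL] with L hdL huL
        haveI := hfin L
        have ht := measureReal_transfer (μ L) (hsupp L) (fun ω hω => (hdL ω hω).1)
          (fun ω hω => (hdL ω hω).2)
        linarith [huL.2]
      have hlimt : Tendsto (fun L => |(μ L).real (E2 δ b s L) -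
          (μ L).real (Uni δ z₀ (fun _ => tt) L ∩ Patt δ z₀ (fun _ => tt) L ∩ B δ b s L)| -
            ε / 3 * (μ L).real (B δ b s L)) atTop (𝓝 (|e2 - x'| - ε / 3 * a')) :=
        ((he2.sub hx').abs).sub (ha'.const_mul (ε / 3))
      linarith [le_of_tendsto hlimt hev]
    -- (3) TV mixing in the limit: `|x/a - x'/a'| ≤ ε/3`
    have h3 : |x / a - x' / a'| ≤ ε / 3 := by
      have hlimt : Tendsto (fun L =>
          |(μ L).real (Uni δ z₀ (fun _ => tt) L ∩ Patt δ z₀ (fun _ => tt) L ∩ A δ z L) /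
              (μ L).real (A δ z L) -
            (μ L).real (Uni δ z₀ (fun _ => tt) L ∩ Patt δ z₀ (fun _ => tt) L ∩ B δ b s L) /
              (μ L).real (B δ b s L)|) atTop (𝓝 |x / a - x' / a'|) :=
        ((hx.div ha ha0.ne').sub (hx'.div ha' ha0'.ne')).abs
      exact le_of_tendsto hlimt hmixL
    have e1 : |e / a - x / a| ≤ ε / 3 := abs_div_sub_div_le hε3.le h1
    have e2' : |x' / a' - e2 / a'| ≤ ε / 3 := by
      rw [abs_sub_comm]; exact abs_div_sub_div_le hε3.le h2
    calc |e / a - e2 / a'| ≤ |e / a - x / a| + |x / a - e2 / a'| := abs_sub_le _ _ _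
      _ ≤ |e / a - x / a| + (|x / a - x' / a'| + |x' / a' - e2 / a'|) :=
          add_le_add le_rfl (abs_sub_le _ _ _)
      _ ≤ ε / 3 + (ε / 3 + ε / 3) := add_le_add e1 (add_le_add h3 e2')
      _ = ε := by ring
  · -- VACUOUS CASE: no point of the neighbourhood lies well inside this inner family
    refine Filter.Eventually.of_forall fun δ z hz hzin => (hin fun j x hx => ?_).elim
    rw [mem_closedBall] at hx
    have h1 := mem_ball.1 (hzin j)
    have h2 := mem_ball.1 (hz.2 j)
    have h3 := hs₆ j
    rw [mem_ball]
    calc dist x (z₀ j) ≤ dist x (b j) + dist (b j) (z j) + dist (z j) (z₀ j) := dist_triangle4 _ _ _ _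
      _ < (fun _ : ι => tt) j / 2 := by rw [dist_comm (b j) (z j)]; simp only; linarith

end Summit.CriticalPhenomena.Ising3DConformalLimit.Theorems.EvenPatternDecoupling
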